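import Summits.QuantumFields.YangMills.Theorems.BalabanUVNodesN08AxialLaunderingWeighted

/-!
# BalabanUVNodes ∕ N08 — LAUNDERING WITH SPECTATORS: a finite measure on `Y × Γ` invariant under right translations of the group coordinate is `(marginal) ⊗ Haar`;
# hence the straight transporter pushes `f·dU_j`, JOINTLY with any spectator `φ` not reading the last bonds, to `((f·dU_j)∘φ⁻¹) ⊗ dU_{j+1}` — the laundered coarse
# field is exactly Haar AND independent of the spectator

Track A, DAG node N08 = [Balaban1985UV3] Thm 1 p. 257 ∕ Thm 2 p. 272 ((41) p. 266); averaging [Balaban1987RG1] (0.4) p. 253 (unguarded branch = `AveragingRT.axialAvg`).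
Cell `pub-ymgap`, seat `pub-ymgap-dag-n08-d` g47 on the R529-ym summon (hJ = I-09, N08 loop part; LOCATE §4 (β1)); `--supports stmt-QuantumFields-19936` (helper).
Sequel of ✓`BalabanUVNodesN08AxialLaunderingWeighted` (p754299: the spectator-free case).

THE POINT.  A cluster expansion of the top-ending partial iterates needs, besides «a bump not reading the last bonds is invisible one level up», the INDEPENDENCE form:
the laundered coarse field is exactly Haar AND independent of every other datum that is measurable in the non-last bonds (other clusters' variables, guard events
off the lines, …).  §1 is the abstract fact (Weil's uniqueness fibrewise over a spectator space, by rectangles); §2 the axial instance.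

CONTENTS ([folklore] measure theory; nothing of the paper asserted; 0 `def`, 0 `sorry`):
* §1 ★★ `eq_fst_prod_of_invariant` — `κ` finite on `Y × Γ`, `π` a left-invariant probability on the measurable group `Γ`, `κ∘(id × (·*g))⁻¹ = κ` for all `g` ⇒
  `κ = (κ∘fst⁻¹) ⊗ π`.
* §3 (β2-core) PRIVATE LETTERS: `measurePreserving_update_mul_haarPi`; ★★ `map_prod_mul_private_eq_prod` (a word ending in a private Haar letter is Haar and independent
  of every spectator not reading that letter); `measure_inter_private_eq`; ★★★ `measure_forall_private_chain_eq_prod` — a TRIANGULAR chain of words with private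
  letters is i.i.d. Haar: `P_Haar(∀ k, a_k(U)·U(p_k) ∈ W_k) = Π_k Haar(W_k)` (the «guard fires with probability ≤ hⁿ along a private-bond chain» of the LOCATE, generic).
* §2 ★★★ `map_withDensity_prod_axialAvg_eq` — `((dU_j).withDensity f).map (fun U ↦ (φ U, axialAvg U)) = (((dU_j).withDensity f).map φ).prod (dU_{j+1})` for measurable `f`
  (finite integral) and measurable `φ : fields → Y`, both invariant under right-translation of the last bond of every segment (standing range).
HONEST: count-neutral helper; hTop ∕ (a)′∀ ∕ hJ NOT proved; N08 NOT discharged; R3 ≠ d = 4 ∕ mass gap ∕ Clay.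
-/

noncomputable section

open MeasureTheory
open scoped ENNReal

namespace Summit.QuantumFields.YangMills.Theorems.BalabanUVNodesN08AxialLaunderingSpectator

open Literature.MathematicalPhysics.QuantumFieldTheory.Balaban1983to89
open Literature.MathematicalPhysics.QuantumFieldTheory.Balaban1983to89.AveragingRT
  (axialAvg line measurable_axialAvg axialAvg_mul_last measure_eq_mass_smul_of_invariant measurePreserving_mulRight measurePreserving_mulLeft)
open Summit.QuantumFields.YangMills.Theorems.BalabanUVNodesN08AxialLaunderingWeighted (map_withDensity_eq_of_comp_eq)

/-! ## §1 Weil's uniqueness fibrewise over a spectator space -/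
section Fibrewise

variable {Y Γ : Type*} [MeasurableSpace Y] [Group Γ] [MeasurableSpace Γ] [MeasurableMul₂ Γ]

/-- ★★ **A FINITE MEASURE ON `Y × Γ` INVARIANT UNDER RIGHT TRANSLATIONS OF THE GROUP COORDINATE IS `(marginal) ⊗ π`** for any left-invariant probability `π` on `Γ`:
for each measurable `B ⊆ Y` the `Γ`-marginal of `κ↾(B × Γ)` is finite and right-invariant, hence `κ(B × Γ)•π` (`AveragingRT.measure_eq_mass_smul_of_invariant`); so `κ` and
`(κ∘fst⁻¹) ⊗ π` agree on rectangles (`Measure.prod_eq`). [folklore] -/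
theorem eq_fst_prod_of_invariant (π : Measure Γ) [IsProbabilityMeasure π] (κ : Measure (Y × Γ)) [IsFiniteMeasure κ]
    (hπ : ∀ g : Γ, π.map (fun y => g * y) = π) (hκ : ∀ g : Γ, κ.map (fun p : Y × Γ => (p.1, p.2 * g)) = κ) :
    κ = (κ.map Prod.fst).prod π := by
  haveI : IsFiniteMeasure (κ.map (Prod.fst : Y × Γ → Y)) := Measure.isFiniteMeasure_map κ _
  symm
  refine Measure.prod_eq fun B A hB hA => ?_
  -- the `Γ`-marginal of `κ` restricted to the cylinder over `B`
  set κB : Measure Γ := (κ.restrict (B ×ˢ Set.univ)).map Prod.snd with hκB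
  haveI : IsFiniteMeasure (κ.restrict (B ×ˢ (Set.univ : Set Γ))) := by infer_instance
  haveI : IsFiniteMeasure κB := Measure.isFiniteMeasure_map _ _
  have hcyl : MeasurableSet (B ×ˢ (Set.univ : Set Γ)) := hB.prod MeasurableSet.univ
  -- right-invariance of `κB`
  have hκB_inv : ∀ g : Γ, κB.map (fun x => x * g) = κB := by
    intro g
    have hmg : Measurable (fun x : Γ => x * g) := measurable_mul_const g
    have hT : Measurable (fun p : Y × Γ => (p.1, p.2 * g)) := measurable_fst.prodMk (measurable_snd.mul_const g)
    ext E hE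
    rw [Measure.map_apply hmg hE, hκB, Measure.map_apply measurable_snd (hmg hE), Measure.map_apply measurable_snd hE,
      Measure.restrict_apply (measurable_snd (hmg hE)), Measure.restrict_apply (measurable_snd hE)]
    -- both sides are `κ` of a set; transport the left one by the invariance `hκ g`
    have hset : (Prod.snd ⁻¹' ((fun x : Γ => x * g) ⁻¹' E)) ∩ B ×ˢ (Set.univ : Set Γ) =
        (fun p : Y × Γ => (p.1, p.2 * g)) ⁻¹' ((Prod.snd ⁻¹' E) ∩ B ×ˢ (Set.univ : Set Γ)) := by
      ext p; simp [Set.mem_prod]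
    rw [hset, ← Measure.map_apply hT ((measurable_snd hE).inter hcyl), hκ g]
  have hWeil := measure_eq_mass_smul_of_invariant π κB hπ hκB_inv
  -- evaluate on `A`
  have h1 : κ (B ×ˢ A) = κB A := by
    rw [hκB, Measure.map_apply measurable_snd hA, Measure.restrict_apply (measurable_snd hA)]
    congr 1; ext p; simp [Set.mem_prod, and_comm]
  have h2 : κB Set.univ = κ.map Prod.fst B := by
    rw [hκB, Measure.map_apply measurable_snd MeasurableSet.univ, Set.preimage_univ, Measure.restrict_apply MeasurableSet.univ,
      Set.univ_inter, Measure.map_apply measurable_fst hB]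
    congr 1; ext p; simp [Set.mem_prod]
  rw [h1, hWeil, Measure.smul_apply, smul_eq_mul, h2]

end Fibrewise

/-! ## §2 The straight transporter launders jointly with any spectator that avoids the last bonds -/
section Axial

variable {P : Params} {j : ℕ} {G : Type*} [GaugeGroup G] [MeasurableSpace G] [HaarData G] [MeasurableMul₂ G]
  {Y : Type*} [MeasurableSpace Y]

/-- ★★★ **LAUNDERING WITH SPECTATORS.**  For a measurable density `f ≥ 0` of finite integral and a measurable spectator map `φ` on the level-`j` fields, BOTH invariant
under right-multiplication of the last bond of every straight segment by an arbitrary coarse field, the pair `(φ, Ū_ax)` pushes `f·dU_j` to the PRODUCT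
`((f·dU_j)∘φ⁻¹) ⊗ dU_{j+1}`: the laundered coarse field is exactly product Haar and independent of the spectator (standing range).
[cite: Balaban1987RG1, (0.4) p.253 (the straight transporter); Balaban1985Averaging, (10) p.19 (bookkeeping)] -/
theorem map_withDensity_prod_axialAvg_eq (hj : j + 1 ≤ P.m + P.K) {f : GaugeField P j G → ℝ≥0∞} (hf : Measurable f)
    (hfin : ∫⁻ U, f U ∂(fieldMeasure P j G) ≠ ∞) {φ : GaugeField P j G → Y} (hφ : Measurable φ)
    (hlast : ∀ (g : GaugeField P (j + 1) G) (U : GaugeField P j G),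
      f (fun b => U b * Function.extend (fun c : PBond P (j + 1) => line c (P.L - 1)) g (fun _ => 1) b) = f U)
    (hφlast : ∀ (g : GaugeField P (j + 1) G) (U : GaugeField P j G),
      φ (fun b => U b * Function.extend (fun c : PBond P (j + 1) => line c (P.L - 1)) g (fun _ => 1) b) = φ U) :
    ((fieldMeasure P j G).withDensity f).map (fun U => (φ U, (axialAvg U : GaugeField P (j + 1) G))) =
      (((fieldMeasure P j G).withDensity f).map φ).prod (fieldMeasure P (j + 1) G) := by
  letI : Group (GaugeField P (j + 1) G) := Pi.group
  letI : MeasurableMul₂ (GaugeField P (j + 1) G) := Pi.measurableMul₂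
  have hmeas : Measurable (axialAvg : GaugeField P j G → GaugeField P (j + 1) G) := measurable_axialAvg
  have hpair : Measurable (fun U : GaugeField P j G => (φ U, (axialAvg U : GaugeField P (j + 1) G))) := hφ.prodMk hmeas
  haveI : IsFiniteMeasure ((fieldMeasure P j G).withDensity f) := isFiniteMeasure_withDensity hfin
  set κ := ((fieldMeasure P j G).withDensity f).map (fun U => (φ U, (axialAvg U : GaugeField P (j + 1) G))) with hκ
  haveI : IsFiniteMeasure κ := Measure.isFiniteMeasure_map _ _
  have hfst : κ.map Prod.fst = ((fieldMeasure P j G).withDensity f).map φ := by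
    rw [hκ, Measure.map_map measurable_fst hpair]; rfl
  rw [← hfst]
  refine eq_fst_prod_of_invariant (fieldMeasure P (j + 1) G) κ (fun g => (measurePreserving_mulLeft (P := P) (j := j + 1) g).map_eq) fun g => ?_
  -- right-invariance in the coarse coordinate: translate the last bonds
  set R : GaugeField P j G → GaugeField P j G := fun U b =>
    U b * Function.extend (fun c : PBond P (j + 1) => line c (P.L - 1)) g (fun _ => 1) b with hR
  have hRmp : MeasurePreserving R (fieldMeasure P j G) (fieldMeasure P j G) := measurePreserving_mulRight _
  have hRf : ((fieldMeasure P j G).withDensity f).map R = (fieldMeasure P j G).withDensity f :=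
    map_withDensity_eq_of_comp_eq hRmp hf (fun U => hlast g U)
  have hT : Measurable (fun p : Y × GaugeField P (j + 1) G => (p.1, p.2 * g)) := measurable_fst.prodMk (measurable_snd.mul_const g)
  have hcomp : ((fun p : Y × GaugeField P (j + 1) G => (p.1, p.2 * g)) ∘ (fun U : GaugeField P j G => (φ U, (axialAvg U : GaugeField P (j + 1) G))))
      = (fun U : GaugeField P j G => (φ U, (axialAvg U : GaugeField P (j + 1) G))) ∘ R := by
    funext U
    show (φ U, (fun c => axialAvg U c * g c)) = (φ (R U), axialAvg (R U))
    rw [hR, axialAvg_mul_last hj, hφlast g U]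
    rfl
  calc κ.map (fun p => (p.1, p.2 * g))
      = ((fieldMeasure P j G).withDensity f).map ((fun p : Y × GaugeField P (j + 1) G => (p.1, p.2 * g)) ∘
          (fun U => (φ U, (axialAvg U : GaugeField P (j + 1) G)))) := by rw [hκ, Measure.map_map hT hpair]
    _ = ((fieldMeasure P j G).withDensity f).map ((fun U => (φ U, (axialAvg U : GaugeField P (j + 1) G))) ∘ R) := by rw [hcomp]
    _ = (((fieldMeasure P j G).withDensity f).map R).map (fun U => (φ U, (axialAvg U : GaugeField P (j + 1) G))) :=
        (Measure.map_map hpair hRmp.measurable).symm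
    _ = κ := by rw [hRf]

end Axial

/-! ## §3 (β2-core) PRIVATE LETTERS: a word ending in a private Haar letter is exactly Haar and independent of everything that does not read that letter;
a triangular chain of such words is an i.i.d. Haar family — the «private-bond chain» bound `P_Haar(all guards fire) = Π_k Haar(W_k)` -/
section PrivateLetters

variable {ι : Type*} [Fintype ι] {G : Type*} [GaugeGroup G] [MeasurableSpace G] [HaarData G] [MeasurableMul₂ G]
  {Y : Type*} [MeasurableSpace Y]

/-- Right-multiplying ONE coordinate of a product-Haar family by a constant preserves product Haar. [folklore] -/
theorem measurePreserving_update_mul_haarPi [DecidableEq ι] (p : ι) (g : G) :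
    MeasurePreserving (fun (U : ι → G) => Function.update U p (U p * g))
      (Measure.pi fun _ : ι => (HaarData.haar : Measure G)) (Measure.pi fun _ : ι => (HaarData.haar : Measure G)) := by
  have h := measurePreserving_pi (fun _ : ι => (HaarData.haar : Measure G)) (fun _ => HaarData.haar)
    (f := fun b x => x * Function.update (fun _ : ι => (1 : G)) p g b)
    (fun b => ⟨measurable_mul_const _, HaarData.map_mul_right _⟩)
  have hfun : (fun (U : ι → G) => Function.update U p (U p * g)) =
      fun (U : ι → G) (b : ι) => U b * Function.update (fun _ : ι => (1 : G)) p g b := by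
    funext U b
    by_cases hb : b = p
    · subst hb; simp
    · simp [Function.update_of_ne hb]
  rw [hfun]; exact h

/-- ★★ **A WORD ENDING IN A PRIVATE HAAR LETTER IS HAAR AND INDEPENDENT OF ITS SPECTATORS**: under product Haar on `ι → G`, if `a` and the spectator `φ` do not read the
coordinate `p` (invariance under `U ↦ update U p (U p * g)`), then `U ↦ (φ U, a U * U p)` has law `(law of φ) ⊗ Haar` (§1 with the one-coordinate right translation).
[folklore] -/
theorem map_prod_mul_private_eq_prod [DecidableEq ι] (p : ι) {a : (ι → G) → G} (ha : Measurable a) {φ : (ι → G) → Y} (hφ : Measurable φ)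
    (ha' : ∀ (U : ι → G) (g : G), a (Function.update U p (U p * g)) = a U)
    (hφ' : ∀ (U : ι → G) (g : G), φ (Function.update U p (U p * g)) = φ U) :
    (Measure.pi fun _ : ι => (HaarData.haar : Measure G)).map (fun U => (φ U, a U * U p)) =
      ((Measure.pi fun _ : ι => (HaarData.haar : Measure G)).map φ).prod HaarData.haar := by
  set μ : Measure (ι → G) := Measure.pi fun _ : ι => (HaarData.haar : Measure G) with hμ
  have hH : Measurable (fun U : ι → G => a U * U p) := ha.mul (measurable_pi_apply p)
  have hpair : Measurable (fun U : ι → G => (φ U, a U * U p)) := hφ.prodMk hH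
  set κ := μ.map (fun U => (φ U, a U * U p)) with hκ
  haveI : IsFiniteMeasure κ := Measure.isFiniteMeasure_map _ _
  have hfst : κ.map Prod.fst = μ.map φ := by rw [hκ, Measure.map_map measurable_fst hpair]; rfl
  rw [← hfst]
  refine eq_fst_prod_of_invariant (HaarData.haar : Measure G) κ (fun g => HaarData.map_mul_left g) fun g => ?_
  have hR := measurePreserving_update_mul_haarPi (ι := ι) (G := G) p g
  have hT : Measurable (fun q : Y × G => (q.1, q.2 * g)) := measurable_fst.prodMk (measurable_snd.mul_const g)
  have hcomp : ((fun q : Y × G => (q.1, q.2 * g)) ∘ (fun U : ι → G => (φ U, a U * U p))) =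
      (fun U : ι → G => (φ U, a U * U p)) ∘ (fun U : ι → G => Function.update U p (U p * g)) := by
    funext U
    show (φ U, a U * U p * g) = (φ (Function.update U p (U p * g)), a (Function.update U p (U p * g)) * Function.update U p (U p * g) p)
    rw [hφ' U g, ha' U g, Function.update_self, mul_assoc]
  calc κ.map (fun q => (q.1, q.2 * g))
      = μ.map ((fun q : Y × G => (q.1, q.2 * g)) ∘ (fun U => (φ U, a U * U p))) := by rw [hκ, Measure.map_map hT hpair]
    _ = μ.map ((fun U : ι → G => (φ U, a U * U p)) ∘ (fun U => Function.update U p (U p * g))) := by rw [hcomp]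
    _ = (μ.map (fun U : ι → G => Function.update U p (U p * g))).map (fun U => (φ U, a U * U p)) :=
        (Measure.map_map hpair hR.measurable).symm
    _ = κ := by rw [hR.map_eq]

/-- The set form: `P(φ ∈ B, a·U_p ∈ W) = P(φ ∈ B) · Haar(W)`. [folklore] -/
theorem measure_inter_private_eq [DecidableEq ι] (p : ι) {a : (ι → G) → G} (ha : Measurable a) {φ : (ι → G) → Y} (hφ : Measurable φ)
    (ha' : ∀ (U : ι → G) (g : G), a (Function.update U p (U p * g)) = a U)
    (hφ' : ∀ (U : ι → G) (g : G), φ (Function.update U p (U p * g)) = φ U)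
    {B : Set Y} (hB : MeasurableSet B) {W : Set G} (hW : MeasurableSet W) :
    (Measure.pi fun _ : ι => (HaarData.haar : Measure G)) ({U | φ U ∈ B} ∩ {U | a U * U p ∈ W}) =
      (Measure.pi fun _ : ι => (HaarData.haar : Measure G)) {U | φ U ∈ B} * HaarData.haar W := by
  have hpair : Measurable (fun U : ι → G => (φ U, a U * U p)) := hφ.prodMk (ha.mul (measurable_pi_apply p))
  have h := map_prod_mul_private_eq_prod p ha hφ ha' hφ'
  have h1 : (Measure.pi fun _ : ι => (HaarData.haar : Measure G)) ({U | φ U ∈ B} ∩ {U | a U * U p ∈ W}) =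
      ((Measure.pi fun _ : ι => (HaarData.haar : Measure G)).map (fun U => (φ U, a U * U p))) (B ×ˢ W) := by
    rw [Measure.map_apply hpair (hB.prod hW)]; rfl
  rw [h1, h, Measure.prod_prod, Measure.map_apply hφ hB]; rfl

/-- ★★★ **THE PRIVATE-LETTER CHAIN IS I.I.D. HAAR — the probability that ALL words of a triangular chain land in prescribed sets is the PRODUCT of the Haar
masses.**  Words `H_k(U) = a_k(U)·U(p_k)`, `k < n`, with `p` injective and `a_k` not reading the private letters `p_m`, `m ≥ k` (triangularity; every loop
holonomy can be rotated to end in its private bond, and the guard sets are conjugation-invariant): `P_Haar(∀ k, H_k ∈ W_k) = Π_k Haar(W_k)` — for one guard of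
`blockAvg ℰp` with `n` private-bond loops and `W_k = {dist1 < δ}` this is the «`≤ hⁿ`» of the LOCATE (`h = Haar{dist1 < δ}`). [folklore] -/
theorem measure_forall_private_chain_eq_prod [DecidableEq ι] :
    ∀ (n : ℕ) (p : Fin n → ι) (_hp : Function.Injective p) (a : Fin n → (ι → G) → G) (_ha : ∀ k, Measurable (a k))
      (_ha' : ∀ (k m : Fin n), k ≤ m → ∀ (U : ι → G) (g : G), a k (Function.update U (p m) (U (p m) * g)) = a k U)
      (W : Fin n → Set G) (_hW : ∀ k, MeasurableSet (W k)),
      (Measure.pi fun _ : ι => (HaarData.haar : Measure G)) {U | ∀ k, a k U * U (p k) ∈ W k} = ∏ k, HaarData.haar (W k)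
  | 0, p, _, a, _, _, W, _ => by
    haveI : IsProbabilityMeasure (Measure.pi fun _ : ι => (HaarData.haar : Measure G)) := Measure.pi.instIsProbabilityMeasure _
    simp
  | n + 1, p, hp, a, ha, ha', W, hW => by
    -- peel the LAST word: spectator = the first `n` words
    set φ : (ι → G) → (Fin n → G) := fun U k => a (Fin.castSucc k) U * U (p (Fin.castSucc k)) with hφdef
    have hφ : Measurable φ := measurable_pi_iff.mpr fun k => (ha _).mul (measurable_pi_apply _)
    have hlast_ne : ∀ k : Fin n, p (Fin.castSucc k) ≠ p (Fin.last n) := fun k h =>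
      (Fin.castSucc_lt_last k).ne (hp h)
    have hφ' : ∀ (U : ι → G) (g : G), φ (Function.update U (p (Fin.last n)) (U (p (Fin.last n)) * g)) = φ U := by
      intro U g; funext k
      show a (Fin.castSucc k) _ * Function.update U _ _ (p (Fin.castSucc k)) = a (Fin.castSucc k) U * U (p (Fin.castSucc k))
      rw [ha' (Fin.castSucc k) (Fin.last n) (Fin.castSucc_lt_last k).le U g, Function.update_of_ne (hlast_ne k)]
    set B : Set (Fin n → G) := {v | ∀ k, v k ∈ W (Fin.castSucc k)} with hBdef
    have hB : MeasurableSet B := by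
      have : B = ⋂ k, (fun v : Fin n → G => v k) ⁻¹' W (Fin.castSucc k) := by ext v; simp [hBdef]
      rw [this]; exact MeasurableSet.iInter fun k => measurable_pi_apply k (hW _)
    have hsplit : {U : ι → G | ∀ k : Fin (n + 1), a k U * U (p k) ∈ W k} =
        {U | φ U ∈ B} ∩ {U | a (Fin.last n) U * U (p (Fin.last n)) ∈ W (Fin.last n)} := by
      ext U
      simp only [Set.mem_setOf_eq, Set.mem_inter_iff, hBdef, hφdef]
      constructor
      · intro h; exact ⟨fun k => h _, h _⟩
      · rintro ⟨h1, h2⟩ k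
        rcases Fin.eq_castSucc_or_eq_last k with ⟨k', rfl⟩ | rfl
        · exact h1 k'
        · exact h2
    rw [hsplit, measure_inter_private_eq (p (Fin.last n)) (ha _) hφ (fun U g => ha' _ _ le_rfl U g) hφ' hB (hW _)]
    -- the spectator event is the chain of the first `n` words
    have hIH := measure_forall_private_chain_eq_prod n (fun k => p (Fin.castSucc k)) (fun k k' h => Fin.castSucc_injective n (hp h))
      (fun k => a (Fin.castSucc k)) (fun k => ha _)
      (fun k m hkm U g => ha' (Fin.castSucc k) (Fin.castSucc m) (Fin.castSucc_le_castSucc_iff.mpr hkm) U g)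
      (fun k => W (Fin.castSucc k)) (fun k => hW _)
    have hev : {U : ι → G | φ U ∈ B} = {U | ∀ k : Fin n, a (Fin.castSucc k) U * U (p (Fin.castSucc k)) ∈ W (Fin.castSucc k)} := by
      ext U; simp [hBdef, hφdef]
    rw [hev, hIH, Fin.prod_univ_castSucc]

end PrivateLetters

end Summit.QuantumFields.YangMills.Theorems.BalabanUVNodesN08AxialLaunderingSpectator

end
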